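import Summits.QuantumFields.YangMills.Theorems.BalabanUVNodesN18TermsAtRecord
import Summits.QuantumFields.YangMills.Theorems.BalabanUVNodesN18HLayerDatumCauchy

/-!
# BalabanUVNodes ∕ N18 — `N18At` AT THE H-LAYER BUNDLE ON THE CARRIERS OF RECORD FROM (2.14)-DISPLAY DATA IN THE DATA DIRECTION
# (Track A, DAG node N18 = NE5 `T4OutputRate.NE5 EA EB W κ θ C₅` :211; cluster K4 «SpineRates»; file 3 of seat pub-ymgap-dag-n18-c;
# the s1 ∘ s2 junction split of record: the TERM layer is seat n18-d's `BalabanUVNodesN18TermsAtRecord`, the DISPLAY layer is this file)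

HONEST FRAMING.  Count-neutral kernel bookkeeping (seat pub-ymgap-dag-n18-c g0; `--supports stmt-QuantumFields-19676`): ONE application
each of two LANDED files — seat n18-d's `BalabanUVNodesN18TermsAtRecord` (p453396: `YMDAG.N18.HLayer.n18At_of_terms226_record`, N18's decl of
record `YMDAG.UVSplit.N18At` at the H-layer bundle on `B13Carriers.TwoRuns.carriers`, member by member, the activities instanced as the printed
TERM SUMS `act j z Z := Σ_{t ∈ terms L M Z} T j Z t z` and the W2 wall taken as TERM data (hol) + (226) in the data direction — itself ONE
application of this seat's `N18HLayerDatum.ne5_of_leaves_fibre_terms226_record_eps`, p450706) and this seat's `BalabanUVNodesN18HLayerDatumCauchy`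
(p451803: the term data PRODUCED from the (2.14)-DISPLAY data `T j Z t z = term214 r lZ lD (Ψ j Z t z) 0 0` — Ψ's separate σ∕τ-holomorphy at the
printed radii, CORNER VALUES holomorphic on the data box, the Gaussian sup bound (2.15)–(2.25) UNIFORM there).  Every analytic letter is a
HYPOTHESIS (NODE A's estimate re-read on the class (1.5) p. 3; NODE O's objects, instance 0∕1); the leaves L01–L03 ∕ L05–L09unit on Bałaban's
runs (rows NE2∕NE3 for L07∕L08) are displayed; NE5 is NOT IN PRINT ([Balaban1987RG1] Thm 1 p. 259) and NOT PROVED; NO `Node00/` rate-record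
home `RRec` has landed, so nothing here discharges N18; one finite four-torus programme at fixed ε; nothing continuum ∕ ℝ⁴ ∕ OS ∕ mass-gap ∕
Clay.  0 `def`, 0 `sorry`.

* `n18At_of_display214_record` — `N18At ⟨Rr.carriers, W, γ, κ, EA, EB, θ′, C₅(C₃ε₁), Λ, C₉, ωm, cr, ρ⟩` for per-member step models `M b` whose
  output IS (2.13) of the term sums, FROM per-member (2.14)-DISPLAY DATA around every admissible box (`hD`), Lemma 3's printed restrictions and
  the Cauchy-layer side conditions (`κ₁ ≥ 1`, `Uσ ⊇ {|σ| ≤ e^{κ₁}}`, `Uτ`, contour radius `0 < r ≤ e^{κ₁} − 1`), the located numerals, the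
  leaves and the sharp clause — `YMDAG.N18.HLayer.n18At_of_terms226_record` with `hT b := termData_of_display214_record … (M b) … (hD b)`.
* `n18At_of_display214_record_eps` — the same with BOTH W2 clauses as ONE ε₁-threshold on the record's small-field parameter `c.ε₁`
  (`EnvelopeOnRecord.eps_threshold_record` at `C₃ := c.C3act`), the member data quantified after the threshold.
So the deepest layer at which N18's decl of record is reached through route P1 is now the (2.14)-display in the data direction — the SAME layer at
which the two-run END reads its pencil (`TwoRunTorusRateCauchy`) and row (D4) its seam; one layer further down, per term and with no new file,
`TwoRunTorusWalkParam.hol_and_h226_torus_of_termWalkData_param` (ANY parameter space; take `B := Op × Hist`) delivers the term data from ONE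
`B13TermWalkData.TermKernels` record with `TermWalkData` — NODE O's statement (v) read in the data direction.

Sources: T. Bałaban, CMP **116** (1988) [Balaban1988RG2Cluster] (1.5) p. 3, (2.13)–(2.15) pp. 14–15, (2.16)–(2.18) p. 16, (2.26) p. 17,
Lemma 3 (2.38) p. 20, (2.39)–(2.41) p. 21; CMP **109** (1987) [Balaban1987RG1] (0.24) p. 257, Thm 1 p. 259.  Nothing here is a claim about
the Yang–Mills mass gap.
-/

noncomputable section

namespace Summit.QuantumFields.YangMills.BalabanUVNodes.N18AtTerms226

open Set Metric Finset
open Literature.MathematicalPhysics.QuantumFieldTheory.Balaban1983to89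
open Literature.MathematicalPhysics.QuantumFieldTheory.Balaban1983to89.T4OutputRate (Carriers Functional NE5)
open Literature.MathematicalPhysics.QuantumFieldTheory.Balaban1983to89.T4InputCauchyRateData (StepModel)
open Literature.MathematicalPhysics.QuantumFieldTheory.Balaban1983to89.TreeLengthTorus (TPt TDom tsys torusTreeLen)
open Literature.MathematicalPhysics.QuantumFieldTheory.Balaban1983to89.TreeLengthTorusGeometry (TTouch)
open Literature.MathematicalPhysics.QuantumFieldTheory.Balaban1983to89.TreeLengthTorusTransfer (tclosure)
open Literature.MathematicalPhysics.QuantumFieldTheory.Balaban1983to89.B13Lemma3TorusData (TBond)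
open Literature.MathematicalPhysics.QuantumFieldTheory.Balaban1983to89.B13Lemma3TorusTerms (terms weight Z0)
open Literature.MathematicalPhysics.QuantumFieldTheory.Balaban1983to89.B13Term214 (term214 SepHolOn)
open Literature.MathematicalPhysics.QuantumFieldTheory.Balaban1983to89.B13Bound143 (invTau)
open Literature.MathematicalPhysics.QuantumFieldTheory.Balaban1983to89.B12TreeDecay (kappa₀ K₀)
open Literature.MathematicalPhysics.QuantumFieldTheory.Balaban1983to89.B13Resummation (locE)
open Summit.QuantumFields.BalabanUV.T4Continuum.B13Carriers (TwoRuns)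
open Summit.QuantumFields.BalabanUV.T4Continuum.Spine.NE5
open Summit.QuantumFields.YangMills.BalabanUVNodes.N18HLayerDatumCauchy (termData_of_display214_record)
open YMDAG.UVSplit (U3Carriers N18At)
open YMDAG.N18.HLayer (n18At_of_terms226_record)

section Numerics

/-! Lemma 3's printed restrictions on the constants — ONE set for all scales and all members (verbatim files 1–2 and n18-d's module 2). -/

variable {L Mb : ℕ} [NeZero L] [NeZero Mb] (c : B13.Consts) (hL : 8 ≤ c.L) (hLc : c.L = L) {a a₂ a₂' a₅ Aabs : ℝ}
variable (hα₆ : 0 < c.α₆) (hε₀ : 0 ≤ c.eps2) (hδ : 0 ≤ c.δ) (hδ7 : 0 ≤ 1 - 7 * c.δ) (hκ : 0 ≤ c.κ) (ha : 0 ≤ a)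
  (hR15 : c.R15) (hR16 : 18 * ((1 - 4 * c.δ) * c.κ) ≤ a / 20) (hR16' : 4 * c.κ ≤ a / 20)
  (hR17 : Real.exp (-(a / 20)) ≤ c.eps2) (h231 : 2 * (4 : ℝ) * (Mb : ℝ) ^ 4 * Real.exp (-(a / 10)) ≤ a / 20)
  (ha₂ : 0 ≤ a₂) (hκ229 : kappa₀ 64 8 + a₂ ≤ c.δ * c.κ)
  (hsm229 : c.α₆ * Real.exp a₂ * K₀ 64 8 * 64 ≤ a₂)
  (habsk : Real.exp (-(a / 20)) * 64 ≤ c.δ * c.κ)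
  (h18half : B13Step237.R18half c (K₀ 64 8 * Real.exp (Real.exp (-(a / 20)) * 64)))
  (h18 : B13Step237.R18sharp c (K₀ 64 8 * Real.exp (Real.exp (-(a / 20)) * 64)) ((c.L : ℝ) / 2))
  (ha₂' : 0 ≤ a₂') (hκ229' : kappa₀ 64 8 + a₂' ≤ c.δ * ((c.L : ℝ) / 2) * c.κ)
  (hsm229' : c.α₆ * Real.exp a₂' * K₀ 64 8 * 64 ≤ a₂')
  (hR20 : 18 * ((1 - 7 * c.δ) * ((c.L : ℝ) / 2) * c.κ) ≤ (c.κ₁ - 1) / 2)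
  (ha₅ : 0 ≤ a₅) (habs : a₅ + Real.exp (-((c.κ₁ - 1) / 2)) ≤ Aabs)
  (hAc : Aabs * 64 ≤ c.δ * ((c.L : ℝ) / 2) * c.κ)
  (hC3 : B13Step237.bracketF c (K₀ 64 8 * Real.exp (Real.exp (-(a / 20)) * 64)) / c.α₆ *
    Real.exp (Aabs * 64) ≤ c.C3act * c.ε₁)

include hL hLc hα₆ hε₀ hδ hδ7 hκ ha hR15 hR16 hR16' hR17 h231 ha₂ hκ229 hsm229 habsk h18half h18 ha₂' hκ229' hsm229'
  hR20 ha₅ habs hAc hC3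

variable {G : Type} [GaugeGroup G] (Rr : TwoRuns G)
variable {Op Hist : Type*} [NormedAddCommGroup Op] [NormedSpace ℂ Op] [NormedAddCommGroup Hist] [NormedSpace ℂ Hist]
-- decidability instances as BINDERS (they unify with any consumer's; `Spine/NE5/EnvelopeOnRecord` TECHNICAL NOTE)
variable [∀ j, DecidableEq (TDom 4 (Rr.cubesPerDir j))] [∀ j, DecidableRel (TTouch (d := 4) (N := Rr.cubesPerDir j))]

/-! ## `N18At` from per-member (2.14)-display data in the data direction -/

variable (hκ₁ : 1 ≤ c.κ₁) {Uσ Uτ : Set ℂ} (hUσ : IsOpen Uσ) (hUτ : IsOpen Uτ)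
  (hUexp : closedBall (0 : ℂ) (Real.exp c.κ₁) ⊆ Uσ) {r : ℝ} (hr : 0 < r) (hr' : r ≤ Real.exp c.κ₁ - 1)
  (hsubτ : ∀ s ∈ Set.uIcc (0 : ℝ) 1, closedBall (s : ℂ) r ⊆ Uτ)

/-! The per-scale Cauchy data of the record (the `j`-th torus): the (2.18) radii at scale `j` (positive, `invTau ≤ ½`, their closed
discs inside `Uτ`) and the σ∕τ-enumerations `lZ j Z t` of the blocks of `Z∖Z′₀` and `lD j t` of `𝐃`. -/
variable
  (hpos : ∀ j, ∀ Y : TDom 4 (L * Rr.cubesPerDir j), 0 < invTau c ((tsys 4 (L * Rr.cubesPerDir j)).dj Y))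
  (h2 : ∀ j, ∀ Y : TDom 4 (L * Rr.cubesPerDir j), invTau c ((tsys 4 (L * Rr.cubesPerDir j)).dj Y) ≤ 1 / 2)
  (hUtau : ∀ j, ∀ Y : TDom 4 (L * Rr.cubesPerDir j),
    closedBall (0 : ℂ) ((invTau c ((tsys 4 (L * Rr.cubesPerDir j)).dj Y))⁻¹) ⊆ Uτ)
  (lZ : (j : ℕ) → TDom 4 (Rr.cubesPerDir j) →
    Finset (TDom 4 (L * Rr.cubesPerDir j)) × Finset (TBond 4 Mb (L * Rr.cubesPerDir j)) → List (TPt 4 (Rr.cubesPerDir j)))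
  (hlZ : ∀ j Z t, (lZ j Z t).Nodup ∧ (lZ j Z t).toFinset = Z.1 \ tclosure L (Rr.cubesPerDir j) (Z0 Mb t))
  (lD : (j : ℕ) → Finset (TDom 4 (L * Rr.cubesPerDir j)) × Finset (TBond 4 Mb (L * Rr.cubesPerDir j)) →
    List (TDom 4 (L * Rr.cubesPerDir j)))
  (hlD : ∀ j t, (lD j t).Nodup ∧ (lD j t).toFinset = t.1)

include hκ₁ hUσ hUτ hUexp hr hr' hsubτ hpos h2 hUtau hlZ hlD

/-- **N18 AT THE H-LAYER BUNDLE ON THE CARRIERS OF RECORD FROM PER-MEMBER (2.14)-DISPLAY DATA.**  Seat n18-d's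
`YMDAG.N18.HLayer.n18At_of_terms226_record` (the term layer) with its term data `hT` MANUFACTURED, member by member, from the (2.14)-display
data of file 2 (`N18HLayerDatumCauchy.termData_of_display214_record`): per member `b`, per scale `j`, the
(2.18) radii inside `Uτ`, the σ∕τ-enumerations, the terms `T b j Z t` AS the (2.14)-display `term214 r (lZ j Z t) (lD j t) (Ψ b j Z t z) 0 0`
on an open `V ⊇ (M b).box j p` around every admissible box, each `Ψ b j Z t z` (`z ∈ V`) separately holomorphic in `σ` on
`Uσ ⊇ {|σ| ≤ e^{κ₁}}` and in `τ` on `Uτ`, the corner values holomorphic on `V`, the Gaussian sup bound (2.15)–(2.25) UNIFORM on `V` (`hD`) —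
the SAME layer at which the two-run END reads its pencil and row (D4) its seam. [cite: Balaban1988RG2Cluster, (2.14)–(2.15) p.15, (2.18) p.16, (2.26) p.17, (2.38) p.20; Balaban1987RG1, Thm 1 p.259] -/
theorem n18At_of_display214_record (M : ℝ → StepModel Rr.carriers Op Hist)
    (T : ℝ → (j : ℕ) → (Z : TDom 4 (Rr.cubesPerDir j)) →
      Finset (TDom 4 (L * Rr.cubesPerDir j)) × Finset (TBond 4 Mb (L * Rr.cubesPerDir j)) → Op × Hist → ℂ)
    (Ψ : ℝ → (j : ℕ) → (Z : TDom 4 (Rr.cubesPerDir j)) →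
      Finset (TDom 4 (L * Rr.cubesPerDir j)) × Finset (TBond 4 Mb (L * Rr.cubesPerDir j)) → Op × Hist →
      (TPt 4 (Rr.cubesPerDir j) → ℂ) → (TDom 4 (L * Rr.cubesPerDir j) → ℂ) → ℂ)
    {W : Set (ℕ → ℝ)} {γ κ : ℝ}
    {EA : Functional Rr.carriers Rr.carriers.BgA} {EB : ℝ → Functional Rr.carriers Rr.carriers.BgB}
    {EA₀ E₀ E₁ δ δ' θ θ' cH ω ρ₀ B : ℝ} {k₀ : ℕ}
    (hrep : ∀ b : ℝ, 0 < b → b ≤ γ → ∀ (X : Rr.carriers.Dom) (z : Op × Hist),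
      (M b).Out X.1 z.1 z.2 X =
        locE (TTouch (d := 4) (N := Rr.cubesPerDir X.1)) (fun Z : (tsys 4 (Rr.cubesPerDir X.1)).Dom => Z.1)
          (fun Z => ∑ t ∈ terms L Mb Z, T b X.1 Z t z) X.2.1)
    (hC3nn : 0 ≤ c.C3act) (hε₁ : 0 ≤ c.ε₁) (hκ0 : 0 ≤ κ)
    (hrate : κ + 2 * (64 * Real.log 162) + 2 ≤ (1 - 8 * c.δ) * ((c.L : ℝ) / 2) * c.κ)
    (hKP : c.C3act * c.ε₁ * Real.exp (5 * κ + 1) * K₀ 64 8 * 9 * 64 ≤ 1)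
    (hD : ∀ b : ℝ, 0 < b → b ≤ γ → ∀ j, ∀ g ∈ W, ∀ (U : Rr.carriers.BgB) (p : Op × Hist), p ∈ (M b).Base j g U →
      ∃ V : Set (Op × Hist), IsOpen V ∧ (M b).box j p ⊆ V ∧
        (∀ Z t, ∀ z ∈ V, T b j Z t z = term214 r (lZ j Z t) (lD j t) (Ψ b j Z t z) 0 0) ∧
        (∀ Z t, ∀ z ∈ V, ∀ τ : TDom 4 (L * Rr.cubesPerDir j) → ℂ, (∀ i, τ i ∈ Uτ) →
          SepHolOn Uσ (fun σ => Ψ b j Z t z σ τ)) ∧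
        (∀ Z t, ∀ z ∈ V, ∀ σ : TPt 4 (Rr.cubesPerDir j) → ℂ, (∀ i, σ i ∈ Uσ) →
          SepHolOn Uτ (fun τ => Ψ b j Z t z σ τ)) ∧
        (∀ Z t (σ : TPt 4 (Rr.cubesPerDir j) → ℂ) (τ : TDom 4 (L * Rr.cubesPerDir j) → ℂ), (∀ i, σ i ∈ Uσ) →
          (∀ i, τ i ∈ Uτ) → DifferentiableOn ℂ (fun z => Ψ b j Z t z σ τ) V) ∧
        (∀ Z t, ∀ z ∈ V, ∀ (σ : TPt 4 (Rr.cubesPerDir j) → ℂ) (τ : TDom 4 (L * Rr.cubesPerDir j) → ℂ),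
          (∀ i, ‖σ i‖ ≤ Real.exp c.κ₁) → (∀ Y, ‖τ Y‖ ≤ (invTau c ((tsys 4 (L * Rr.cubesPerDir j)).dj Y))⁻¹) →
          ‖Ψ b j Z t z σ τ‖ ≤ Real.exp (-(a / 2 * (t.2.card : ℝ))) * Real.exp (a₅ * ((Z.1).card : ℝ))))
    (l01 : ∀ b : ℝ, 0 < b → b ≤ γ → L01 (M b) EA W) (l02 : ∀ b : ℝ, 0 < b → b ≤ γ → L02 (M b) (EB b) W)
    (l03 : ∀ b : ℝ, 0 < b → b ≤ γ → L03 (M b) (EB b) W) (l05 : L05 EA W EA₀ κ)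
    (l06 : ∀ b : ℝ, 0 < b → b ≤ γ → L06 (EB b) W E₀ κ) (l07 : ∀ b : ℝ, 0 < b → b ≤ γ → L07 (M b) W δ θ)
    (l08 : ∀ b : ℝ, 0 < b → b ≤ γ → L08 (M b) W κ E₀ δ' θ) (l09aff : ∀ b : ℝ, 0 < b → b ≤ γ → L09aff (M b) W)
    (l09blind : ∀ b : ℝ, 0 < b → b ≤ γ → L09blind (M b) W) (l09hom : ∀ b : ℝ, 0 < b → b ≤ γ → L09hom (M b) W)
    (l09unit : ∀ b : ℝ, 0 < b → b ≤ γ → L09unit (M b) W κ E₁ cH ω)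
    (hE₁ : 0 < E₁) (hδδ' : 0 ≤ δ + δ') (hθ : 0 ≤ θ) (hθθ' : θ ≤ θ') (hθ'1 : θ' ≤ 1) (hcH : 0 ≤ cH) (hω : 0 < ω)
    (hρ₀ : ρ₀ < 1) (l10near : (δ + δ') * θ ^ k₀ + cH * (EA₀ + E₀) / (1 - ω) ≤ ρ₀) (hB : 0 ≤ B)
    (l10first : ∀ k < k₀, EA₀ + E₀ ≤ B * θ ^ k)
    (hS : Real.exp 1 * 9 * 64 * K₀ 64 8 ^ 2 * c.C3act * cH * c.ε₁ < (θ' - ω) * (1 - ρ₀))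
    (Λ : ℕ → ℕ → ℝ) (C₉ ωm cr ρ : ℝ) :
    N18At ⟨Rr.carriers, W, γ, κ, EA, EB, θ',
      (Real.exp 1 * 9 * 64 * K₀ 64 8 ^ 2 * (c.C3act * c.ε₁) / (1 - ρ₀) * (δ + δ') + B) * (θ' - ω) /
        (θ' - (ω + Real.exp 1 * 9 * 64 * K₀ 64 8 ^ 2 * (c.C3act * c.ε₁) / (1 - ρ₀) * cH)), Λ, C₉, ωm, cr, ρ⟩ :=
  n18At_of_terms226_record c hL hLc hα₆ hε₀ hδ hδ7 hκ ha hR15 hR16 hR16' hR17 h231 ha₂ hκ229 hsm229 habsk h18half h18 ha₂'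
    hκ229' hsm229' hR20 ha₅ habs hAc hC3 Rr M T hrep hC3nn hε₁ hκ0 hrate hKP
    (fun b hb hbγ => termData_of_display214_record c hα₆ hκ₁ hUσ hUτ hUexp hr hr' hsubτ Rr (M b) hpos h2 hUtau lZ hlZ lD hlD
      (T b) (Ψ b) (hD b hb hbγ))
    l01 l02 l03 l05 l06 l07 l08 l09aff l09blind l09hom l09unit hE₁ hδδ' hθ hθθ' hθ'1 hcH hω hρ₀ l10near hB l10first hS Λ C₉
    ωm cr ρ

/-- **THE SAME WITH BOTH W2 CLAUSES AS ONE ε₁-THRESHOLD ON THE RECORD's SMALL-FIELD PARAMETER.**  For Lemma 3's constants with `ω < θ′`,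
`ρ₀ < 1`, `0 ≤ c_H` there is `ε⋆ > 0` (`EnvelopeOnRecord.eps_threshold_record` at `C₃ := c.C3act`) such that whenever `c.ε₁ < ε⋆`, EVERY member
data (step models, terms, underintegral expressions, functionals) obeying (2.13) over the term sums, the ∃V-form of the (2.14)-display data and
the leaves gives `N18At` with `C₅(c.C3act·c.ε₁)` — the [KP86] clause and the sharp clause DISCHARGED by the smallness of `ε₁` (the pattern of
n18-d's `n18At_of_terms226_record_eps`, one layer down). [cite: Balaban1988RG2Cluster, (2.14)–(2.15) p.15, Lemma 3 (2.38)–(2.41) pp.20–21] -/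
theorem n18At_of_display214_record_eps {W : Set (ℕ → ℝ)} {γ κ EA₀ E₀ E₁ δ δ' θ θ' cH ω ρ₀ B : ℝ} {k₀ : ℕ}
    (hC3nn : 0 ≤ c.C3act) (hε₁ : 0 ≤ c.ε₁) (hκ0 : 0 ≤ κ)
    (hrate : κ + 2 * (64 * Real.log 162) + 2 ≤ (1 - 8 * c.δ) * ((c.L : ℝ) / 2) * c.κ)
    (hE₁ : 0 < E₁) (hδδ' : 0 ≤ δ + δ') (hθ : 0 ≤ θ) (hθθ' : θ ≤ θ') (hθ'1 : θ' ≤ 1) (hcH : 0 ≤ cH) (hω : 0 < ω)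
    (hωθ' : ω < θ') (hρ₀ : ρ₀ < 1) (l10near : (δ + δ') * θ ^ k₀ + cH * (EA₀ + E₀) / (1 - ω) ≤ ρ₀) (hB : 0 ≤ B)
    (l10first : ∀ k < k₀, EA₀ + E₀ ≤ B * θ ^ k) (Λ : ℕ → ℕ → ℝ) (C₉ ωm cr ρ : ℝ) :
    ∃ εs : ℝ, 0 < εs ∧ (c.ε₁ < εs →
      ∀ (M : ℝ → StepModel Rr.carriers Op Hist)
        (T : ℝ → (j : ℕ) → (Z : TDom 4 (Rr.cubesPerDir j)) →
          Finset (TDom 4 (L * Rr.cubesPerDir j)) × Finset (TBond 4 Mb (L * Rr.cubesPerDir j)) → Op × Hist → ℂ)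
        (Ψ : ℝ → (j : ℕ) → (Z : TDom 4 (Rr.cubesPerDir j)) →
          Finset (TDom 4 (L * Rr.cubesPerDir j)) × Finset (TBond 4 Mb (L * Rr.cubesPerDir j)) → Op × Hist →
          (TPt 4 (Rr.cubesPerDir j) → ℂ) → (TDom 4 (L * Rr.cubesPerDir j) → ℂ) → ℂ)
        (EA : Functional Rr.carriers Rr.carriers.BgA) (EB : ℝ → Functional Rr.carriers Rr.carriers.BgB),
        (∀ b : ℝ, 0 < b → b ≤ γ → ∀ (X : Rr.carriers.Dom) (z : Op × Hist),
          (M b).Out X.1 z.1 z.2 X =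
            locE (TTouch (d := 4) (N := Rr.cubesPerDir X.1)) (fun Z : (tsys 4 (Rr.cubesPerDir X.1)).Dom => Z.1)
              (fun Z => ∑ t ∈ terms L Mb Z, T b X.1 Z t z) X.2.1) →
        (∀ b : ℝ, 0 < b → b ≤ γ → ∀ j, ∀ g ∈ W, ∀ (U : Rr.carriers.BgB) (p : Op × Hist), p ∈ (M b).Base j g U →
          ∃ V : Set (Op × Hist), IsOpen V ∧ (M b).box j p ⊆ V ∧
            (∀ Z t, ∀ z ∈ V, T b j Z t z = term214 r (lZ j Z t) (lD j t) (Ψ b j Z t z) 0 0) ∧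
            (∀ Z t, ∀ z ∈ V, ∀ τ : TDom 4 (L * Rr.cubesPerDir j) → ℂ, (∀ i, τ i ∈ Uτ) →
              SepHolOn Uσ (fun σ => Ψ b j Z t z σ τ)) ∧
            (∀ Z t, ∀ z ∈ V, ∀ σ : TPt 4 (Rr.cubesPerDir j) → ℂ, (∀ i, σ i ∈ Uσ) →
              SepHolOn Uτ (fun τ => Ψ b j Z t z σ τ)) ∧
            (∀ Z t (σ : TPt 4 (Rr.cubesPerDir j) → ℂ) (τ : TDom 4 (L * Rr.cubesPerDir j) → ℂ), (∀ i, σ i ∈ Uσ) →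
              (∀ i, τ i ∈ Uτ) → DifferentiableOn ℂ (fun z => Ψ b j Z t z σ τ) V) ∧
            (∀ Z t, ∀ z ∈ V, ∀ (σ : TPt 4 (Rr.cubesPerDir j) → ℂ) (τ : TDom 4 (L * Rr.cubesPerDir j) → ℂ),
              (∀ i, ‖σ i‖ ≤ Real.exp c.κ₁) → (∀ Y, ‖τ Y‖ ≤ (invTau c ((tsys 4 (L * Rr.cubesPerDir j)).dj Y))⁻¹) →
              ‖Ψ b j Z t z σ τ‖ ≤ Real.exp (-(a / 2 * (t.2.card : ℝ))) * Real.exp (a₅ * ((Z.1).card : ℝ)))) →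
        (∀ b : ℝ, 0 < b → b ≤ γ → L01 (M b) EA W) → (∀ b : ℝ, 0 < b → b ≤ γ → L02 (M b) (EB b) W) →
        (∀ b : ℝ, 0 < b → b ≤ γ → L03 (M b) (EB b) W) → L05 EA W EA₀ κ → (∀ b : ℝ, 0 < b → b ≤ γ → L06 (EB b) W E₀ κ) →
        (∀ b : ℝ, 0 < b → b ≤ γ → L07 (M b) W δ θ) → (∀ b : ℝ, 0 < b → b ≤ γ → L08 (M b) W κ E₀ δ' θ) →
        (∀ b : ℝ, 0 < b → b ≤ γ → L09aff (M b) W) → (∀ b : ℝ, 0 < b → b ≤ γ → L09blind (M b) W) →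
        (∀ b : ℝ, 0 < b → b ≤ γ → L09hom (M b) W) → (∀ b : ℝ, 0 < b → b ≤ γ → L09unit (M b) W κ E₁ cH ω) →
        N18At ⟨Rr.carriers, W, γ, κ, EA, EB, θ',
          (Real.exp 1 * 9 * 64 * K₀ 64 8 ^ 2 * (c.C3act * c.ε₁) / (1 - ρ₀) * (δ + δ') + B) * (θ' - ω) /
            (θ' - (ω + Real.exp 1 * 9 * 64 * K₀ 64 8 ^ 2 * (c.C3act * c.ε₁) / (1 - ρ₀) * cH)), Λ, C₉, ωm, cr, ρ⟩) := by
  obtain ⟨εs, hεs, hthr⟩ := eps_threshold_record (κ := κ) hC3nn hcH hωθ' hρ₀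
  refine ⟨εs, hεs, fun hε₁s M T Ψ EA EB hrep hD l01 l02 l03 l05 l06 l07 l08 l09aff l09blind l09hom l09unit => ?_⟩
  obtain ⟨hKP, hS⟩ := hthr c.ε₁ hε₁s
  exact n18At_of_display214_record c hL hLc hα₆ hε₀ hδ hδ7 hκ ha hR15 hR16 hR16' hR17 h231 ha₂ hκ229 hsm229 habsk h18half h18
    ha₂' hκ229' hsm229' hR20 ha₅ habs hAc hC3 Rr hκ₁ hUσ hUτ hUexp hr hr' hsubτ hpos h2 hUtau lZ hlZ lD hlD M T Ψ hrep hC3nn hε₁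
    hκ0 hrate hKP hD l01 l02 l03 l05 l06 l07 l08 l09aff l09blind l09hom l09unit hE₁ hδδ' hθ hθθ' hθ'1 hcH hω hρ₀ l10near hB
    l10first hS Λ C₉ ωm cr ρ

end Numerics

end Summit.QuantumFields.YangMills.BalabanUVNodes.N18AtTerms226

end
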